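import Summits.Parity.GeneralizedHardyLittlewood.Theorems.BeyondDiagonalBeatsQuarter.MellinBumpMoebius
import Summits.Parity.GeneralizedHardyLittlewood.Theorems.BeyondDiagonalBeatsQuarter.MellinBumpAbel
import HarnessLib

/-!
# Route `PrimeLevelFamEdge`, crux K_B (stmt-Parity-20343), line `diagonal_kernel_split`:
# **prover check C1 — the Mellin-bump lemma** (GATE G1 §4 (iv) / §6 C1)

For every `k`, every Lipschitz constant `K` and support window `[a, b] ⊂ (0, ∞)` there is `C` such that for
ALL `K`-Lipschitz `h` supported in `[a, b]`, all `M > 1` and all `Y ≥ 1`: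
`|Σ_{m₁,m₂ ≤ M} (x_{m₁}/m₁)(x_{m₂}/m₂)·h(m₁m₂/Y)| ≤ C/(1 + log Y)^k`,
`x_m = μ(m)ψ(m)⁻¹(log(M/m)/log M)²` the KMV `X²` mollifier coefficients (`KernelFormXSq.xsq`). Uniform in
`M` (no relation between `M` and `Y` is assumed) and in `h` within the class — this is the form in which the
transition-window terms of the dual side (G2 row a7: Bessel transitions `A ≍ c²q`, aliasing of the `s`-sum)
and the prime-vs-integer density mismatch (G1 §4 (v), a8P) are families of bumps indexed by `c`.
Proof (G1 §4 (iv) «Elementarily»): symmetrise to `m₁ ≤ m₂` (so `m₂ ≥ √(aY)` on the support and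
`m₁ ≤ √(bY)`), Abel-sum the `m₂`-variable against `A(e) = Σ_{m ≤ e} μ(m)/(mψ(m)) ≪_k (1 + log e)^{−k−1}`
(`MellinBumpMoebius`), the weight `(log(M/m₂)/log M)²·h(m₁m₂/Y)` having variation `≤ K(5b + 2)`
(`MellinBumpAbel`), and sum `1/m₁` over `m₁ ≤ √(bY)`. What this lemma is NOT: it says nothing about which
bumps the dual side produces (that is Ω-d, helpers H5/H6 behind the gates); it is the q-free tool they cite.
Helper toward the heart stub; closes nothing; theorems only; standard axioms.
«The programme SEARCHES and TYPES; no claim about Landau–Siegel zeros, Theorems 1–2 of arXiv:2211.02515 or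
a repaired Margin232 until a kernel theorem says so.»
-/

noncomputable section

open scoped Real ArithmeticFunction.Moebius
open Finset ArithmeticFunction

namespace Summit.Parity.GeneralizedHardyLittlewood.Theorems.BeyondDiagonalBeatsQuarter.MellinBump

open Literature.NumberTheory.LFunctions Literature.NumberTheory.LFunctions.KMV2000
open MollifierMainTerm (W)
open KernelFormXSq

/-! ### The partial-sum bound in threshold form -/

/-- **Threshold form of `abs_sum_W_le`.** `|A(e)| ≤ D_k/(1 + log Y)^k` for every natural `e ≥ √(aY) − 1`
and every `Y ≥ 1` (for `Y ≥ 16(1 + a⁻²)` one has `e ≥ √(aY)/2` and `1 + log e ≥ (1 + log Y)/4`; below,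
the crude bound `|A(e)| ≤ C_k` is absorbed into the constant). [cite: MontgomeryVaughan2007, §8.1 (8.6) — derivation] -/
theorem abs_sum_W_le_threshold (k : ℕ) {a : ℝ} (ha : 0 < a) :
    ∃ D : ℝ, 0 < D ∧ ∀ Y : ℝ, 1 ≤ Y → ∀ e : ℕ, Real.sqrt (a * Y) - 1 ≤ (e : ℝ) →
      |∑ j ∈ Icc 1 e, W j| ≤ D / (1 + Real.log Y) ^ k := by
  obtain ⟨C, hC, hCb⟩ := abs_sum_W_le k
  set Y₀ : ℝ := 16 * (1 + a⁻¹ ^ 2) with hY₀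
  have hY₀16 : 16 ≤ Y₀ := by rw [hY₀]; nlinarith [sq_nonneg a⁻¹]
  have hLY₀ : 0 ≤ Real.log Y₀ := Real.log_nonneg (by linarith)
  refine ⟨C * 4 ^ k * (1 + Real.log Y₀) ^ k, by positivity, fun Y hY e he ↦ ?_⟩
  have hLY : 0 ≤ Real.log Y := Real.log_nonneg hY
  have hpowY : 0 < (1 + Real.log Y) ^ k := by positivity
  rcases Nat.eq_zero_or_pos e with rfl | he1
  · simp only [show Icc 1 0 = ∅ by rfl, Finset.sum_empty, abs_zero]; positivity
  have hA := hCb e he1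
  have he0 : (1 : ℝ) ≤ e := by exact_mod_cast he1
  have hle : 0 ≤ Real.log e := Real.log_nonneg he0
  have hone : 1 ≤ (1 + Real.log Y₀) ^ k := one_le_pow₀ (by linarith)
  by_cases hYY : Y₀ ≤ Y
  · have key : (1 + Real.log Y) / 4 ≤ 1 + Real.log e := by
      have haY : 16 ≤ a * Y := by
        have h1 : a * Y₀ ≤ a * Y := mul_le_mul_of_nonneg_left hYY ha.le
        have h2 : a * Y₀ = 16 * (a + a⁻¹) := by rw [hY₀]; field_simp
        have h3 : 2 ≤ a + a⁻¹ := by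
          have h4 : a + a⁻¹ - 2 = (a - 1) ^ 2 / a := by field_simp; ring
          have h5 : 0 ≤ (a - 1) ^ 2 / a := by positivity
          linarith
        nlinarith
      have hs4 : 4 ≤ Real.sqrt (a * Y) := by
        rw [show (4 : ℝ) = Real.sqrt (4 ^ 2) by rw [Real.sqrt_sq (by norm_num)]]
        exact Real.sqrt_le_sqrt (by norm_num; linarith)
      have he2 : Real.sqrt (a * Y) / 2 ≤ e := by linarith
      have hlog1 : Real.log (Real.sqrt (a * Y) / 2) ≤ Real.log e :=
        Real.log_le_log (by positivity) he2
      have hlog2 : Real.log (Real.sqrt (a * Y) / 2) = (Real.log a + Real.log Y) / 2 - Real.log 2 := by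
        rw [Real.log_div (by positivity) (by norm_num), Real.log_sqrt (by positivity),
          Real.log_mul ha.ne' (by linarith)]
      have hlog3 : Real.log 2 < 0.7 := by have := Real.log_two_lt_d9; linarith
      have hYa : -2 * Real.log a ≤ Real.log Y := by
        have h1 : a⁻¹ ^ 2 ≤ Y := by
          have : a⁻¹ ^ 2 ≤ Y₀ := by rw [hY₀]; nlinarith [sq_nonneg a⁻¹]
          linarith
        have h2 : Real.log (a⁻¹ ^ 2) ≤ Real.log Y := Real.log_le_log (by positivity) h1
        rw [Real.log_pow, Real.log_inv] at h2
        push_cast at h2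
        linarith
      linarith
    have hpos4 : 0 < (1 + Real.log Y) / 4 := by positivity
    calc |∑ j ∈ Icc 1 e, W j| ≤ C / (1 + Real.log e) ^ k := hA
      _ ≤ C / ((1 + Real.log Y) / 4) ^ k :=
          div_le_div_of_nonneg_left hC.le (by positivity) (pow_le_pow_left₀ hpos4.le key k)
      _ = C * 4 ^ k / (1 + Real.log Y) ^ k := by rw [div_pow]; field_simp
      _ ≤ C * 4 ^ k * (1 + Real.log Y₀) ^ k / (1 + Real.log Y) ^ k :=
          div_le_div_of_nonneg_right (le_mul_of_one_le_right (by positivity) hone) hpowY.le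
  · push Not at hYY
    have h1 : (1 + Real.log Y) ^ k ≤ (1 + Real.log Y₀) ^ k :=
      pow_le_pow_left₀ (by positivity) (by linarith [Real.log_le_log (by linarith) hYY.le]) k
    calc |∑ j ∈ Icc 1 e, W j| ≤ C / (1 + Real.log e) ^ k := hA
      _ ≤ C := div_le_self hC.le (one_le_pow₀ (by linarith))
      _ = C * 1 * 1 := by ring
      _ ≤ C * 4 ^ k * ((1 + Real.log Y₀) ^ k / (1 + Real.log Y) ^ k) := by
          gcongr
          · exact one_le_pow₀ (by norm_num)
          · rw [le_div_iff₀ hpowY]; linarith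
      _ = C * 4 ^ k * (1 + Real.log Y₀) ^ k / (1 + Real.log Y) ^ k := by ring

/-! ### The inner (`m₂`) sum -/

/-- **The inner sum after Abel summation.** For `m₁ ≥ 1`, `u + 1 ≥ m₁`, `m₁/Y ≤ b + 1` and partial sums
`|A(e)| ≤ η` beyond `√(aY) − 1`:
`|Σ_{u < m₂ ≤ ⌊M⌋} W(m₂)·λ_M(m₂)·h(m₁m₂/Y)| ≤ η·K(5b + 2)`. The weight moves only at `m₂ ≥ max(m₁, aY/m₁) − 1
≥ √(aY) − 1`. [folklore] -/
theorem abs_inner_le {h : ℝ → ℝ} {a b K : ℝ} (ha : 0 < a) (hab : a ≤ b) (hK : 0 ≤ K)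
    (hLip : ∀ x y, |h x - h y| ≤ K * |x - y|) (hsupp : ∀ y, h y ≠ 0 → a ≤ y ∧ y ≤ b)
    {M Y η : ℝ} (hM : 1 < M) (hY : 1 ≤ Y) (hη : 0 ≤ η)
    (hA : ∀ e : ℕ, Real.sqrt (a * Y) - 1 ≤ (e : ℝ) → |∑ j ∈ Icc 1 e, W j| ≤ η)
    {m₁ u : ℕ} (hm₁ : 1 ≤ m₁) (hu : m₁ ≤ u + 1) (huN : u ≤ ⌊M⌋₊) (hc : (m₁ : ℝ) / Y ≤ b + 1) :
    |∑ m₂ ∈ Ioc u ⌊M⌋₊, W m₂ * (logWeight M m₂ * h ((m₁ : ℝ) / Y * m₂))| ≤ η * (K * (5 * b + 2)) := by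
  have hY0 : 0 < Y := by linarith
  have hm0 : (0 : ℝ) < m₁ := by exact_mod_cast hm₁
  have hc0 : 0 < (m₁ : ℝ) / Y := by positivity
  have hB : ∀ y, |h y| ≤ K * b := abs_le_of_lip ha hab hK hLip hsupp
  -- where the weight moves, the partial sums are small
  have hmove : ∀ e, u ≤ e → e ≤ ⌊M⌋₊ →
      ((fun e : ℕ ↦ logWeight M e * h ((m₁ : ℝ) / Y * e)) e ≠ 0 ∨
        (fun e : ℕ ↦ logWeight M e * h ((m₁ : ℝ) / Y * e)) (e + 1) ≠ 0) →
      |∑ j ∈ Icc 1 e, (fun j : ℕ ↦ W j) j| ≤ η := by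
    intro e hue _ hmv
    apply hA
    have hex : a * Y / m₁ ≤ (e : ℝ) + 1 := by
      rcases hmv with h1 | h1
      · have hh : h ((m₁ : ℝ) / Y * e) ≠ 0 := fun h0 ↦ h1 (by simp only [h0, mul_zero])
        have h2 := (hsupp _ hh).1
        rw [show (m₁ : ℝ) / Y * e = (m₁ : ℝ) * e / Y by ring, le_div_iff₀ hY0] at h2
        rw [div_le_iff₀ hm0]
        nlinarith
      · have hh : h ((m₁ : ℝ) / Y * ((e + 1 : ℕ) : ℝ)) ≠ 0 := fun h0 ↦ h1 (by simp only [h0, mul_zero])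
        have h2 := (hsupp _ hh).1
        push_cast at h2
        rw [show (m₁ : ℝ) / Y * ((e : ℝ) + 1) = (m₁ : ℝ) * ((e : ℝ) + 1) / Y by ring,
          le_div_iff₀ hY0] at h2
        rw [div_le_iff₀ hm0]
        linarith
    have hm : (m₁ : ℝ) ≤ (e : ℝ) + 1 := by exact_mod_cast (by omega : m₁ ≤ e + 1)
    have hprod : a * Y ≤ ((e : ℝ) + 1) ^ 2 := by
      have e1 : (m₁ : ℝ) * (a * Y / m₁) = a * Y := by field_simp
      calc a * Y = (m₁ : ℝ) * (a * Y / m₁) := e1.symm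
        _ ≤ ((e : ℝ) + 1) * ((e : ℝ) + 1) := mul_le_mul hm hex (by positivity) (by positivity)
        _ = ((e : ℝ) + 1) ^ 2 := by ring
    have : Real.sqrt (a * Y) ≤ (e : ℝ) + 1 := by
      rw [← Real.sqrt_sq (by positivity : (0 : ℝ) ≤ (e : ℝ) + 1)]
      exact Real.sqrt_le_sqrt hprod
    linarith
  have hφN : (fun e : ℕ ↦ logWeight M e * h ((m₁ : ℝ) / Y * e)) (⌊M⌋₊ + 1) = 0 := by
    simp only [logWeight_of_lt (Nat.lt_succ_self _), zero_mul]
  have habel := abs_sum_mul_le_of_tv (fun j : ℕ ↦ W j)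
    (fun e : ℕ ↦ logWeight M e * h ((m₁ : ℝ) / Y * e)) huN hmove hφN
  -- total variation of the weight
  have hTVl : ∑ e ∈ Ioc u ⌊M⌋₊, |logWeight M e - logWeight M (e + 1)| ≤ logWeight M (u + 1) :=
    tv_antitone_le _ huN (logWeight_nonneg M) (fun e hue ↦ logWeight_succ_le hM (by omega))
  have hTVg : ∑ e ∈ Ioc u ⌊M⌋₊, |h ((m₁ : ℝ) / Y * e) - h ((m₁ : ℝ) / Y * (e + 1))| ≤
      K * (b - a) + 2 * K * ((m₁ : ℝ) / Y) := tv_comp_mul_le ha hab hK hc0 hLip hsupp _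
  have h1 := tv_mul_le (logWeight M) (fun e : ℕ ↦ h ((m₁ : ℝ) / Y * e)) (Ioc u ⌊M⌋₊)
    (abs_logWeight_le_one hM) (fun n ↦ hB _)
  push_cast at h1 habel
  have hlu : logWeight M (u + 1) ≤ 1 := logWeight_le_one hM (by omega)
  have hφu : |logWeight M (u + 1) * h ((m₁ : ℝ) / Y * ((u : ℝ) + 1))| ≤ K * b := by
    rw [abs_mul]
    calc |logWeight M (u + 1)| * |h ((m₁ : ℝ) / Y * ((u : ℝ) + 1))| ≤ 1 * (K * b) :=
          mul_le_mul (abs_logWeight_le_one hM _) (hB _) (abs_nonneg _) zero_le_one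
      _ = K * b := one_mul _
  have hKb : 0 ≤ K * b := mul_nonneg hK (by linarith)
  have hTV : ∑ e ∈ Ioc u ⌊M⌋₊, |logWeight M e * h ((m₁ : ℝ) / Y * e) -
      logWeight M (e + 1) * h ((m₁ : ℝ) / Y * ((e : ℝ) + 1))| ≤ K * b + (K * b + 2 * K * (b + 1)) := by
    refine h1.trans ?_
    have hA' : K * b * ∑ e ∈ Ioc u ⌊M⌋₊, |logWeight M e - logWeight M (e + 1)| ≤ K * b * 1 :=
      mul_le_mul_of_nonneg_left (hTVl.trans hlu) hKb
    have hB' : K * (b - a) + 2 * K * ((m₁ : ℝ) / Y) ≤ K * b + 2 * K * (b + 1) := by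
      nlinarith [mul_le_mul_of_nonneg_left hc (by linarith : (0 : ℝ) ≤ 2 * K)]
    linarith
  calc |∑ m₂ ∈ Ioc u ⌊M⌋₊, W m₂ * (logWeight M m₂ * h ((m₁ : ℝ) / Y * m₂))|
      ≤ η * (∑ e ∈ Ioc u ⌊M⌋₊, |logWeight M e * h ((m₁ : ℝ) / Y * e) -
          logWeight M (e + 1) * h ((m₁ : ℝ) / Y * ((e : ℝ) + 1))| +
          |logWeight M (u + 1) * h ((m₁ : ℝ) / Y * ((u : ℝ) + 1))|) := habel
    _ ≤ η * (K * b + (K * b + 2 * K * (b + 1)) + K * b) := by gcongr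
    _ = η * (K * (5 * b + 2)) := by ring

/-! ### Symmetrisation and assembly -/

/-- `{m₂ ∈ [1, N] : m₁ ≤ m₂} = (m₁ − 1, N]` for `m₁ ≥ 1`. [folklore] -/
theorem filter_le_eq_Ioc {m₁ N : ℕ} (hm₁ : 1 ≤ m₁) :
    (Icc 1 N).filter (fun m₂ : ℕ ↦ m₁ ≤ m₂) = Ioc (m₁ - 1) N := by
  ext m; simp only [Finset.mem_filter, Finset.mem_Icc, Finset.mem_Ioc]; omega

/-- `{m₂ ∈ [1, N] : m₁ < m₂} = (m₁, N]`. [folklore] -/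
theorem filter_lt_eq_Ioc (m₁ N : ℕ) :
    (Icc 1 N).filter (fun m₂ : ℕ ↦ m₁ < m₂) = Ioc m₁ N := by
  ext m; simp only [Finset.mem_filter, Finset.mem_Icc, Finset.mem_Ioc]; omega

/-- **Symmetrisation.** For a symmetric summand,
`Σ_{m₁,m₂ ≤ N} F = Σ_{m₁ ≤ N} (Σ_{m₁ ≤ m₂ ≤ N} F + Σ_{m₁ < m₂ ≤ N} F)`. [folklore] -/
theorem sum_sum_eq_sum_upper (F : ℕ → ℕ → ℝ) (hF : ∀ x y, F x y = F y x) (N : ℕ) :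
    ∑ m₁ ∈ Icc 1 N, ∑ m₂ ∈ Icc 1 N, F m₁ m₂ =
      ∑ m₁ ∈ Icc 1 N, (∑ m₂ ∈ Ioc (m₁ - 1) N, F m₁ m₂ + ∑ m₂ ∈ Ioc m₁ N, F m₁ m₂) := by
  have hA : ∀ m₁ ∈ Icc 1 N, ∑ m₂ ∈ Ioc (m₁ - 1) N, F m₁ m₂ =
      ∑ m₂ ∈ Icc 1 N, (if m₁ ≤ m₂ then F m₁ m₂ else 0) := by
    intro m₁ hm₁
    rw [Finset.mem_Icc] at hm₁
    rw [← filter_le_eq_Ioc hm₁.1, Finset.sum_filter]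
  have hB : ∀ m₁ ∈ Icc 1 N, ∑ m₂ ∈ Ioc m₁ N, F m₁ m₂ =
      ∑ m₂ ∈ Icc 1 N, (if m₁ < m₂ then F m₁ m₂ else 0) := by
    intro m₁ _
    rw [← filter_lt_eq_Ioc, Finset.sum_filter]
  have hC : ∑ m₁ ∈ Icc 1 N, ∑ m₂ ∈ Icc 1 N, (if m₂ < m₁ then F m₁ m₂ else 0) =
      ∑ m₁ ∈ Icc 1 N, ∑ m₂ ∈ Icc 1 N, (if m₁ < m₂ then F m₁ m₂ else 0) := by
    rw [Finset.sum_comm]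
    exact Finset.sum_congr rfl fun x _ ↦ Finset.sum_congr rfl fun y _ ↦ by
      split_ifs <;> first | rfl | exact hF _ _
  calc ∑ m₁ ∈ Icc 1 N, ∑ m₂ ∈ Icc 1 N, F m₁ m₂
      = ∑ m₁ ∈ Icc 1 N, ∑ m₂ ∈ Icc 1 N,
          ((if m₁ ≤ m₂ then F m₁ m₂ else 0) + (if m₂ < m₁ then F m₁ m₂ else 0)) := by
        refine Finset.sum_congr rfl fun m₁ _ ↦ Finset.sum_congr rfl fun m₂ _ ↦ ?_
        by_cases h1 : m₁ ≤ m₂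
        · rw [if_pos h1, if_neg (by omega), add_zero]
        · rw [if_neg h1, if_pos (by omega), zero_add]
    _ = ∑ m₁ ∈ Icc 1 N, ∑ m₂ ∈ Icc 1 N, (if m₁ ≤ m₂ then F m₁ m₂ else 0) +
          ∑ m₁ ∈ Icc 1 N, ∑ m₂ ∈ Icc 1 N, (if m₂ < m₁ then F m₁ m₂ else 0) := by
        simp only [Finset.sum_add_distrib]
    _ = ∑ m₁ ∈ Icc 1 N, ∑ m₂ ∈ Icc 1 N, (if m₁ ≤ m₂ then F m₁ m₂ else 0) +
          ∑ m₁ ∈ Icc 1 N, ∑ m₂ ∈ Icc 1 N, (if m₁ < m₂ then F m₁ m₂ else 0) := by rw [hC]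
    _ = ∑ m₁ ∈ Icc 1 N, (∑ m₂ ∈ Ioc (m₁ - 1) N, F m₁ m₂ + ∑ m₂ ∈ Ioc m₁ N, F m₁ m₂) := by
        rw [← Finset.sum_add_distrib]
        exact Finset.sum_congr rfl fun m₁ hm₁ ↦ by rw [hA m₁ hm₁, hB m₁ hm₁]

/-- **C1 — the Mellin-bump lemma (GATE G1 §6 C1, line `diagonal_kernel_split`).** For every `k : ℕ`, every
window `0 < a ≤ b` and Lipschitz constant `K ≥ 0` there is `C > 0` such that for every `K`-Lipschitz
`h : ℝ → ℝ` supported in `[a, b]`, every `M > 1` and every `Y ≥ 1`,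
`|Σ_{m₁,m₂ ≤ M} (x_{m₁}/m₁)(x_{m₂}/m₂) h(m₁m₂/Y)| ≤ C/(1 + log Y)^k`
(`x_m = μ(m)ψ(m)⁻¹(log(M/m)/log M)²`, `KernelFormXSq.xsq`). Uniform in `M` and in `h` within the class.
[cite: KowalskiMichelVanderKam2000, Prop. 5.1 p. 18 — derivation (mollified sums with smooth bump weights via Möbius cancellation); MontgomeryVaughan2007, §8.1 (8.6)] -/
theorem mellinBump_xsq (k : ℕ) {a b K : ℝ} (ha : 0 < a) (hab : a ≤ b) (hK : 0 ≤ K) :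
    ∃ C : ℝ, 0 < C ∧ ∀ h : ℝ → ℝ, (∀ x y, |h x - h y| ≤ K * |x - y|) →
      (∀ y, h y ≠ 0 → a ≤ y ∧ y ≤ b) → ∀ M : ℝ, 1 < M → ∀ Y : ℝ, 1 ≤ Y →
        |∑ m₁ ∈ Icc 1 ⌊M⌋₊, ∑ m₂ ∈ Icc 1 ⌊M⌋₊,
            xsq M m₁ / m₁ * (xsq M m₂ / m₂) * h ((m₁ : ℝ) * m₂ / Y)| ≤ C / (1 + Real.log Y) ^ k := by
  obtain ⟨D, hD, hDb⟩ := abs_sum_W_le_threshold (k + 1) ha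
  have hb : 0 < b := by linarith
  refine ⟨2 * D * (K * (5 * b + 2)) * (1 + |Real.log b|) + 1, by positivity,
    fun h hLip hsupp M hM Y hY ↦ ?_⟩
  set N := ⌊M⌋₊ with hN
  have hY0 : 0 < Y := by linarith
  have hLY : 0 ≤ Real.log Y := Real.log_nonneg hY
  set L : ℝ := 1 + Real.log Y with hL
  have hL1 : 1 ≤ L := by rw [hL]; linarith
  set η : ℝ := D / L ^ (k + 1) with hη
  have hη0 : 0 ≤ η := by positivity
  have hA : ∀ e : ℕ, Real.sqrt (a * Y) - 1 ≤ (e : ℝ) → |∑ j ∈ Icc 1 e, W j| ≤ η := hDb Y hY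
  -- symmetrise
  have hsym : ∀ x y : ℕ, xsq M x / x * (xsq M y / y) * h ((x : ℝ) * y / Y) =
      xsq M y / y * (xsq M x / x) * h ((y : ℝ) * x / Y) := by
    intro x y; rw [mul_comm (xsq M x / x), mul_comm (x : ℝ)]
  rw [sum_sum_eq_sum_upper _ hsym]
  -- inner sums in `W·λ` form
  have hinner : ∀ m₁ ∈ Icc 1 N, ∀ u, m₁ ≤ u + 1 →
      ∑ m₂ ∈ Ioc u N, xsq M m₁ / m₁ * (xsq M m₂ / m₂) * h ((m₁ : ℝ) * m₂ / Y) =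
        xsq M m₁ / m₁ * ∑ m₂ ∈ Ioc u N, W m₂ * (logWeight M m₂ * h ((m₁ : ℝ) / Y * m₂)) := by
    intro m₁ hm₁ u hu
    rw [Finset.mul_sum]
    refine Finset.sum_congr rfl fun m₂ hm₂ ↦ ?_
    rw [Finset.mem_Ioc] at hm₂
    rw [xsq_div_eq (m := m₂) (by omega) hm₂.2, show (m₁ : ℝ) * m₂ / Y = (m₁ : ℝ) / Y * m₂ by ring]
    ring
  -- bound per m₁
  have hX : 0 < Real.sqrt (b * Y) := Real.sqrt_pos.2 (by positivity)
  have hper : ∀ m₁ ∈ Icc 1 N,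
      |∑ m₂ ∈ Ioc (m₁ - 1) N, xsq M m₁ / m₁ * (xsq M m₂ / m₂) * h ((m₁ : ℝ) * m₂ / Y) +
        ∑ m₂ ∈ Ioc m₁ N, xsq M m₁ / m₁ * (xsq M m₂ / m₂) * h ((m₁ : ℝ) * m₂ / Y)| ≤
      (if (m₁ : ℝ) ≤ Real.sqrt (b * Y) then (m₁ : ℝ)⁻¹ else 0) * (2 * η * (K * (5 * b + 2))) := by
    intro m₁ hm₁
    have hm₁' := Finset.mem_Icc.1 hm₁
    have hm0 : (0 : ℝ) < m₁ := by exact_mod_cast hm₁'.1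
    rw [hinner m₁ hm₁ (m₁ - 1) (by omega), hinner m₁ hm₁ m₁ (by omega), ← mul_add, abs_mul]
    split_ifs with hP
    · -- m₁ ≤ √(bY): Abel bound for both inner sums
      have hc : (m₁ : ℝ) / Y ≤ b + 1 := by
        have h1 : Real.sqrt (b * Y) ≤ Real.sqrt b * Y := by
          rw [show Real.sqrt b * Y = Real.sqrt (b * Y ^ 2) by
            rw [Real.sqrt_mul hb.le, Real.sqrt_sq hY0.le]]
          exact Real.sqrt_le_sqrt (by nlinarith [mul_le_mul_of_nonneg_left hY hb.le])
        have h2 : Real.sqrt b ≤ b + 1 := by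
          rw [show b + 1 = Real.sqrt ((b + 1) ^ 2) by rw [Real.sqrt_sq (by linarith)]]
          exact Real.sqrt_le_sqrt (by nlinarith)
        rw [div_le_iff₀ hY0]
        calc (m₁ : ℝ) ≤ Real.sqrt (b * Y) := hP
          _ ≤ Real.sqrt b * Y := h1
          _ ≤ (b + 1) * Y := mul_le_mul_of_nonneg_right h2 hY0.le
      have hI₁ := abs_inner_le ha hab hK hLip hsupp hM hY hη0 hA hm₁'.1 (u := m₁ - 1) (by omega)
        (by omega) hc
      have hI₂ := abs_inner_le ha hab hK hLip hsupp hM hY hη0 hA hm₁'.1 (u := m₁) (by omega)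
        hm₁'.2 hc
      have hw : |xsq M m₁ / m₁| ≤ (m₁ : ℝ)⁻¹ := abs_xsq_div_le hM hm₁'.1 hm₁'.2
      calc |xsq M m₁ / m₁| * |∑ m₂ ∈ Ioc (m₁ - 1) N, W m₂ * (logWeight M m₂ * h ((m₁ : ℝ) / Y * m₂)) +
            ∑ m₂ ∈ Ioc m₁ N, W m₂ * (logWeight M m₂ * h ((m₁ : ℝ) / Y * m₂))|
          ≤ (m₁ : ℝ)⁻¹ * (η * (K * (5 * b + 2)) + η * (K * (5 * b + 2))) :=
            mul_le_mul hw ((abs_add_le _ _).trans (add_le_add hI₁ hI₂)) (abs_nonneg _) (by positivity)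
        _ = (m₁ : ℝ)⁻¹ * (2 * η * (K * (5 * b + 2))) := by ring
    · -- m₁ > √(bY): every term vanishes (m₂ ≥ m₁ forces m₁m₂ > bY)
      push Not at hP
      have hbY : b * Y < (m₁ : ℝ) ^ 2 := by
        have h1 : Real.sqrt (b * Y) ^ 2 = b * Y := Real.sq_sqrt (by positivity)
        nlinarith [Real.sqrt_nonneg (b * Y)]
      have hzero : ∀ u, m₁ ≤ u + 1 →
          ∑ m₂ ∈ Ioc u N, W m₂ * (logWeight M m₂ * h ((m₁ : ℝ) / Y * m₂)) = 0 := by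
        intro u hu
        refine Finset.sum_eq_zero fun m₂ hm₂ ↦ ?_
        rw [Finset.mem_Ioc] at hm₂
        have hm₂' : (m₁ : ℝ) ≤ m₂ := by exact_mod_cast (by omega : m₁ ≤ m₂)
        have hh : h ((m₁ : ℝ) / Y * m₂) = 0 := by
          by_contra hne
          have := (hsupp _ hne).2
          rw [div_mul_eq_mul_div, div_le_iff₀ hY0] at this
          nlinarith
        rw [hh, mul_zero, mul_zero]
      rw [hzero (m₁ - 1) (by omega), hzero m₁ (by omega), add_zero, abs_zero, mul_zero, zero_mul]
  -- sum over m₁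
  have hsum_m₁ : ∑ m₁ ∈ Icc 1 N, (if (m₁ : ℝ) ≤ Real.sqrt (b * Y) then (m₁ : ℝ)⁻¹ else 0) ≤
      (1 + |Real.log b|) * L := by
    rw [← Finset.sum_filter]
    refine (sum_inv_filter_le hX N).trans ?_
    have h1 : Real.log (Real.sqrt (b * Y)) = (Real.log b + Real.log Y) / 2 := by
      rw [Real.log_sqrt (by positivity), Real.log_mul hb.ne' hY0.ne']
    rw [h1, hL]
    have h2 : |(Real.log b + Real.log Y) / 2| ≤ (|Real.log b| + Real.log Y) / 2 := by
      rw [abs_div, abs_of_pos (by norm_num : (0 : ℝ) < 2)]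
      gcongr
      exact (abs_add_le _ _).trans (by rw [abs_of_nonneg hLY])
    nlinarith [abs_nonneg (Real.log b)]
  have hLk : 0 < L ^ k := by positivity
  calc |∑ m₁ ∈ Icc 1 N, (∑ m₂ ∈ Ioc (m₁ - 1) N, xsq M m₁ / m₁ * (xsq M m₂ / m₂) * h ((m₁ : ℝ) * m₂ / Y) +
          ∑ m₂ ∈ Ioc m₁ N, xsq M m₁ / m₁ * (xsq M m₂ / m₂) * h ((m₁ : ℝ) * m₂ / Y))|
      ≤ ∑ m₁ ∈ Icc 1 N, |∑ m₂ ∈ Ioc (m₁ - 1) N, xsq M m₁ / m₁ * (xsq M m₂ / m₂) * h ((m₁ : ℝ) * m₂ / Y) +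
          ∑ m₂ ∈ Ioc m₁ N, xsq M m₁ / m₁ * (xsq M m₂ / m₂) * h ((m₁ : ℝ) * m₂ / Y)| :=
        Finset.abs_sum_le_sum_abs _ _
    _ ≤ ∑ m₁ ∈ Icc 1 N, (if (m₁ : ℝ) ≤ Real.sqrt (b * Y) then (m₁ : ℝ)⁻¹ else 0) *
          (2 * η * (K * (5 * b + 2))) := Finset.sum_le_sum hper
    _ = (∑ m₁ ∈ Icc 1 N, (if (m₁ : ℝ) ≤ Real.sqrt (b * Y) then (m₁ : ℝ)⁻¹ else 0)) *
          (2 * η * (K * (5 * b + 2))) := by rw [Finset.sum_mul]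
    _ ≤ (1 + |Real.log b|) * L * (2 * η * (K * (5 * b + 2))) :=
        mul_le_mul_of_nonneg_right hsum_m₁ (by positivity)
    _ = 2 * D * (K * (5 * b + 2)) * (1 + |Real.log b|) / L ^ k := by
        rw [hη, pow_succ]; field_simp
    _ ≤ (2 * D * (K * (5 * b + 2)) * (1 + |Real.log b|) + 1) / L ^ k :=
        div_le_div_of_nonneg_right (by linarith) hLk.le

end Summit.Parity.GeneralizedHardyLittlewood.Theorems.BeyondDiagonalBeatsQuarter.MellinBump
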